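import Literature.Probability.Percolation.QuadCrossingSquareModel
import Literature.Barriers.CriticalPhenomena.EmbeddingModulusUniquenessProofs
import HarnessLib

/-!
# Geometry of the sheared test boxes (helper for crux `SegmentClosed`, stmt-CriticalPhenomena-5473)

Route `CardySelfDualSegment` of `CriticalPhenomena/CardyFormulaZ2`, line `Sketch`, lead's stub
`stub_confinement`. The test quadrilaterals of the confinement argument are the sheared boxes
`(rectQuad 0 w 0 h).map (shearHomeomorph β)` (`β ∈ ℍ`, Beffara's shear `φ_β(x + iy) = x + β y`):
the parallelogram `{0 < im < h·im β, re β·im/im β < re < re β·im/im β + w}` with arc `0` the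
bottom side `[0, w]` and arc `2` the top side `h β + [0, w]`. This file records its carrier and
arcs, the coordinate bounds of points `2δ`-close to the two arcs, and the distance to the arcs
from inside — the inputs of the gate / inscribed-box lemmas of the line.
-/

noncomputable section

open Set Metric Complex
open Literature.Probability.RandomPlanarGeometry Literature.Probability.Percolation
open Literature.Barriers.CriticalPhenomena

namespace Summit.CriticalPhenomena.CardyFormulaZ2.Cruxes.SegmentClosed.Sketch


/-- Real part of Beffara's shear: `re φ_β(z) = re z + re β · im z`. -/
theorem moduliShear_re' (β z : ℂ) : (moduliShear β z).re = z.re + β.re * z.im := by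
  simp [moduliShear]

/-- **Carrier of the sheared box.** `p ∈ φ_β((0,w)×(0,h))` iff `0 < im p < h im β` and
`re β · im p / im β < re p < re β · im p / im β + w`. -/
theorem mem_shearedBox_carrier {β : ℂ} (hβ : 0 < β.im) {w h : ℝ} (hw : 0 < w) (hh : 0 < h) {p : ℂ} : p ∈ ((rectQuad 0 w 0 h hw hh).map (shearHomeomorph β hβ.ne')).carrier ↔ 0 < p.im ∧ p.im < h * β.im ∧ β.re * p.im / β.im < p.re ∧ p.re < β.re * p.im / β.im + w := by
  rw [MarkedDomain.carrier_map, coe_shearHomeomorph]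
  constructor
  · rintro ⟨z, hz, rfl⟩
    rw [mem_rectQuad_carrier] at hz
    obtain ⟨⟨h1, h2⟩, h3, h4⟩ := hz
    rw [moduliShear_im, moduliShear_re']
    have e : β.re * (β.im * z.im) / β.im = β.re * z.im := by
      field_simp
    rw [e]
    refine ⟨mul_pos hβ h3, by nlinarith, by linarith, by linarith⟩
  · rintro ⟨h1, h2, h3, h4⟩
    refine ⟨⟨p.re - β.re * p.im / β.im, p.im / β.im⟩, ?_, ?_⟩
    · rw [mem_rectQuad_carrier]
      refine ⟨⟨by linarith, by linarith⟩, div_pos h1 hβ, ?_⟩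
      rw [div_lt_iff₀ hβ]; linarith
    · apply Complex.ext
      · rw [moduliShear_re']
        simp only
        field_simp
        ring
      · rw [moduliShear_im]
        simp only
        field_simp

variable {β : ℂ} (hβ : 0 < β.im) {w h : ℝ} (hw : 0 < w) (hh : 0 < h)

/-- **Arc `0` of the sheared box** is the bottom side `[0, w]` (the shear fixes the real axis). -/
theorem mem_shearedBox_arc_zero {p : ℂ} :
    p ∈ ((rectQuad 0 w 0 h hw hh).map (shearHomeomorph β hβ.ne')).arc 0 ↔
      p.im = 0 ∧ p.re ∈ Icc 0 w := by
  rw [MarkedDomain.arc_map, coe_shearHomeomorph]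
  constructor
  · rintro ⟨z, hz, rfl⟩
    rw [mem_rectQuad_arc_zero] at hz
    obtain ⟨h1, h2⟩ := hz
    rw [moduliShear_im, moduliShear_re', h1]
    simpa using h2
  · rintro ⟨h1, h2⟩
    refine ⟨⟨p.re, 0⟩, ?_, ?_⟩
    · rw [mem_rectQuad_arc_zero]; exact ⟨rfl, h2⟩
    · apply Complex.ext
      · rw [moduliShear_re']; simp
      · rw [moduliShear_im]; simp [h1]

/-- **Arc `2` of the sheared box** is the top side `h β + [0, w]`. -/
theorem mem_shearedBox_arc_two {p : ℂ} :
    p ∈ ((rectQuad 0 w 0 h hw hh).map (shearHomeomorph β hβ.ne')).arc 2 ↔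
      p.im = h * β.im ∧ p.re - h * β.re ∈ Icc 0 w := by
  rw [MarkedDomain.arc_map, coe_shearHomeomorph]
  constructor
  · rintro ⟨z, hz, rfl⟩
    rw [mem_rectQuad_arc_two] at hz
    obtain ⟨h1, h2⟩ := hz
    rw [moduliShear_im, moduliShear_re', h1]
    have e : z.re + β.re * h - h * β.re = z.re := by ring
    rw [e]
    exact ⟨by ring, h2⟩
  · rintro ⟨h1, h2⟩
    refine ⟨⟨p.re - h * β.re, h⟩, ?_, ?_⟩
    · rw [mem_rectQuad_arc_two]; exact ⟨rfl, h2⟩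
    · apply Complex.ext
      · rw [moduliShear_re']; simp; ring
      · rw [moduliShear_im]; simp [h1, mul_comm]

/-- The bottom side is nonempty and compact, so `infDist` to it is attained. -/
theorem exists_mem_arc_zero_infDist_eq (p : ℂ) :
    ∃ q ∈ ((rectQuad 0 w 0 h hw hh).map (shearHomeomorph β hβ.ne')).arc 0,
      infDist p (((rectQuad 0 w 0 h hw hh).map (shearHomeomorph β hβ.ne')).arc 0) = dist p q :=
  (MarkedDomain.isCompact_arc _ 0).exists_infDist_eq_dist ⟨_, MarkedDomain.pt_mem_arc_self _ 0⟩ p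

/-- The top side is nonempty and compact, so `infDist` to it is attained. -/
theorem exists_mem_arc_two_infDist_eq (p : ℂ) :
    ∃ q ∈ ((rectQuad 0 w 0 h hw hh).map (shearHomeomorph β hβ.ne')).arc 2,
      infDist p (((rectQuad 0 w 0 h hw hh).map (shearHomeomorph β hβ.ne')).arc 2) = dist p q :=
  (MarkedDomain.isCompact_arc _ 2).exists_infDist_eq_dist ⟨_, MarkedDomain.pt_mem_arc_self _ 2⟩ p

/-- **Points close to the bottom side**: if `infDist p (arc 0) ≤ ε` then `im p ≤ ε` and
`-ε ≤ re p ≤ w + ε`. -/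
theorem bounds_of_infDist_arc_zero_le {p : ℂ} {ε : ℝ}
    (hp : infDist p (((rectQuad 0 w 0 h hw hh).map (shearHomeomorph β hβ.ne')).arc 0) ≤ ε) :
    p.im ≤ ε ∧ -ε ≤ p.re ∧ p.re ≤ w + ε := by
  obtain ⟨q, hq, hd⟩ := exists_mem_arc_zero_infDist_eq hβ hw hh p
  rw [mem_shearedBox_arc_zero hβ] at hq
  obtain ⟨hqi, hq0, hqw⟩ := hq
  rw [hd, dist_eq_norm] at hp
  have h1 : |(p - q).re| ≤ ε := (abs_re_le_norm _).trans hp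
  have h2 : |(p - q).im| ≤ ε := (abs_im_le_norm _).trans hp
  rw [sub_re, abs_le] at h1
  rw [sub_im, hqi, sub_zero, abs_le] at h2
  exact ⟨h2.2, by linarith [h1.1], by linarith [h1.2]⟩

/-- **Points close to the top side**: if `infDist p (arc 2) ≤ ε` then `h im β - ε ≤ im p` and
`h re β - ε ≤ re p ≤ h re β + w + ε`. -/
theorem bounds_of_infDist_arc_two_le {p : ℂ} {ε : ℝ}
    (hp : infDist p (((rectQuad 0 w 0 h hw hh).map (shearHomeomorph β hβ.ne')).arc 2) ≤ ε) :
    h * β.im - ε ≤ p.im ∧ h * β.re - ε ≤ p.re ∧ p.re ≤ h * β.re + w + ε := by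
  obtain ⟨q, hq, hd⟩ := exists_mem_arc_two_infDist_eq hβ hw hh p
  rw [mem_shearedBox_arc_two hβ] at hq
  obtain ⟨hqi, hq0, hqw⟩ := hq
  rw [hd, dist_eq_norm] at hp
  have h1 : |(p - q).re| ≤ ε := (abs_re_le_norm _).trans hp
  have h2 : |(p - q).im| ≤ ε := (abs_im_le_norm _).trans hp
  rw [sub_re, abs_le] at h1
  rw [sub_im, hqi, abs_le] at h2
  exact ⟨by linarith [h2.2], by linarith [h1.1], by linarith [h1.2]⟩

/-- **Distance to the bottom side from above it**: a point with `re p ∈ [0, w]` and `0 ≤ im p`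
is within `im p` of arc `0`. -/
theorem infDist_arc_zero_le {p : ℂ} (hre : p.re ∈ Icc 0 w) (him : 0 ≤ p.im) :
    infDist p (((rectQuad 0 w 0 h hw hh).map (shearHomeomorph β hβ.ne')).arc 0) ≤ p.im := by
  have hq : (⟨p.re, 0⟩ : ℂ) ∈ ((rectQuad 0 w 0 h hw hh).map (shearHomeomorph β hβ.ne')).arc 0 := by
    rw [mem_shearedBox_arc_zero hβ]; exact ⟨rfl, hre⟩
  refine (infDist_le_dist_of_mem hq).trans (le_of_eq ?_)
  rw [dist_eq_norm]
  have e : p - ⟨p.re, 0⟩ = (p.im : ℂ) * I := by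
    apply Complex.ext <;> simp
  rw [e, norm_mul, norm_I, mul_one, norm_real, Real.norm_eq_abs, abs_of_nonneg him]

/-- **Distance to the top side from below it**: a point with `re p - h re β ∈ [0, w]` and
`im p ≤ h im β` is within `h im β - im p` of arc `2`. -/
theorem infDist_arc_two_le {p : ℂ} (hre : p.re - h * β.re ∈ Icc 0 w) (him : p.im ≤ h * β.im) :
    infDist p (((rectQuad 0 w 0 h hw hh).map (shearHomeomorph β hβ.ne')).arc 2) ≤
      h * β.im - p.im := by
  have hq : (⟨p.re, h * β.im⟩ : ℂ) ∈
      ((rectQuad 0 w 0 h hw hh).map (shearHomeomorph β hβ.ne')).arc 2 := by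
    rw [mem_shearedBox_arc_two hβ]; exact ⟨rfl, hre⟩
  refine (infDist_le_dist_of_mem hq).trans (le_of_eq ?_)
  rw [dist_eq_norm]
  have e : p - ⟨p.re, h * β.im⟩ = ((p.im - h * β.im : ℝ) : ℂ) * I := by
    apply Complex.ext <;> simp
  rw [e, norm_mul, norm_I, mul_one, norm_real, Real.norm_eq_abs, abs_of_nonpos (by linarith)]
  ring

end Summit.CriticalPhenomena.CardyFormulaZ2.Cruxes.SegmentClosed.Sketch

end
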